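import Summits.HodgeConjecture.HodgeConjecture.Theorems.EquidimRelDimOfQuotientMaps
import Summits.HodgeConjecture.HodgeConjecture.Theorems.EquidimNoThinPieceOpen
import HarnessLib

/-!
# E-road head in the tree's shape, SOCKETS v7/v8 edition: (F) ⇒ (F′) and (F) ⇒ hDel modulo the isogeny-quotient maps WITH DEGREE

Cell hodgecm-mathlib (D-0151), E-road «EQUIDIM by proof», Hecke-link line; B-plan1 (g15) 2026-08-29T23:19:57Z SOCKET (B) TEXT v7
(the link carries its similitude degree: `HeckeLinkedDeg … (N′ / N)`, ★ p750692 `SiegelHeckeLinkDegree`; the source piece is an open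
immersion again; then v8 2026-08-29T23:43:14Z: `Odd (N′ / N) → Nat.Coprime (N′ / N) (∏ i, δ i) →` as the last two antecedents,
text `B-plan/F-census/SOCKET-B-v8.text` 50c62588).  This file re-runs ★ p748477 `EquidimRelDimOfQuotientMaps` §3 over the v7 glue ★
`EquidimNoThinPieceOpen.noThinPiece_of_quotientMaps₃` (B-p17 (g10), (E-e)) — the v6 heads stay.  THEOREMS ONLY, `--as helper` capital
for `stmt-HodgeConjecture-24835` (count-neutral).  With socket (B) v7 a ★ theorem `hB : ‹hQuot₃›` ((O-y) B-p21 (g14)/B-p04 (g17)):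
`relDim_of_F hF := relDim_of_quotientMaps₃ hF hB` is the sorry-free E-road head (registry v5.3, B-plan2 (g12)) and
`HDel_of_quotientMaps₃ hF hB : HDel`.  HC_CM is proved only modulo the 7 printed citations until rung 0 closes.

## References
* [Lan2013PELCompactifications] K.-W. Lan, *Arithmetic compactifications of PEL-type Shimura varieties* (2013), Thm. 1.4.1.11, Cor. 7.2.3.9–10.
* [GortzWedhorn2020] U. Görtz, T. Wedhorn, *Algebraic Geometry I* (2nd ed. 2020), Prop. 6.15 (1), Thm. 6.28.
* [GortzWedhorn2023] U. Görtz, T. Wedhorn, *Algebraic Geometry II* (2023), Thm. 27.301 (p. 733).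
* [MumfordFogartyKirwan1994] GIT 3rd ed., Ch. 7 §3 Thm. 7.9 (p. 139), App. 7A (p. 235).
-/

set_option autoImplicit false
set_option linter.dupNamespace false  -- `Summit.HodgeConjecture.HodgeConjecture.…` is the cell's layout (D-0017)

noncomputable section

open CategoryTheory CategoryTheory.Limits AlgebraicGeometry Topology IsLocalRing
open Literature.AlgebraicGeometry
open Literature.AlgebraicGeometry.Motives (SchemeOver ComplexPoints AlgPoints specOver)
open Literature.AlgebraicGeometry.AbelianSchemes (PolarizedAbelianSchemeWithLevel)
open Literature.AlgebraicGeometry.ModuliOfAbelianVarieties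
open Literature.AlgebraicGeometry.ModuliOfAbelianVarieties.EquidimOfF
open Literature.NumberTheory.Automorphic (siegelUpperHalfSpace)
open Literature.NumberTheory.Adeles

namespace Summit.HodgeConjecture.HodgeConjecture.Theorems

namespace EquidimRelDimOfQuotientMaps

open SiegelModuli

variable {g N : ℕ} {δ : Fin g → ℕ}

/-! ## SOCKETS v8: the heads over `EquidimNoThinPieceOpen.noThinPiece_of_quotientMaps₃` (v8 binder `hQuot₃`) -/

/-- **EQUIDIM from (F) and the isogeny-quotient maps with degree** (v7 of `smoothOfRelativeDimension_of_quotientMaps`).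
[cite: GortzWedhorn2020, Prop. 6.15 (1) and Thm. 6.28] [cite: GortzWedhorn2023, Thm. 27.301 (p. 733)] -/
theorem smoothOfRelativeDimension_of_quotientMaps₃ (hF : lan2013_siegelFineModuliScheme)
    (hQuot₃ : ∀ (_hF : lan2013_siegelFineModuliScheme) (g N N' : ℕ) (δ δ' : Fin g → ℕ) (_hg : 0 < g)
      (hδ : IsPolarizationType δ) (_hN : 3 ≤ N) (hδ' : IsPolarizationType δ')
      (𝓜 : SiegelFineModuliScheme g N δ) (𝓜' : SiegelFineModuliScheme g N' δ')
      (S'' : SchemeOver ℂ) (ι' : S'' ⟶ (Motives.baseChange ℚ ℂ).obj 𝓜'.M) [IsOpenImmersion ι'.left]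
      (d'' : ℕ) [SmoothOfRelativeDimension d'' S''.hom] (r' : gspFinAdelic δ') (_ : r' ∈ principalLevelSubgroup δ' 1)
      (s' : ComplexPoints S'') (_ : IsThickAtWith hδ' 𝓜' ι' d'' s' r')
      (x : ComplexPoints ((Motives.baseChange ℚ ℂ).obj 𝓜.M)),
      HeckeLinkedDeg 𝓜 𝓜' r' (AlgPoints.map (L := ℂ) ι' s') x (N' / N) → Odd (N' / N) → Nat.Coprime (N' / N) (∏ i, δ i) →
      haveI : IsLocallyNoetherian (specOver ℚ ℂ).left := inferInstanceAs (IsLocallyNoetherian (Spec (CommRingCat.of ℂ)))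
      ∃ (Φ : ComplexPoints S'' → ComplexPoints ((Motives.baseChange ℚ ℂ).obj 𝓜.M)) (_ : Continuous Φ) (_ : Φ s' = x)
        (θ : siegelUpperHalfSpace g → siegelUpperHalfSpace g) (_ : IsOpenMap θ)
        (r : gspFinAdelic δ) (_ : r ∈ principalLevelSubgroup δ 1),
        ∀ (s : ComplexPoints S'') (Z : siegelUpperHalfSpace g)
          (P' : PolarizedAbelianSchemeWithLevel g N' δ' (specOver ℚ ℂ).left),
          IsAdmissibleAt hδ' r' Z.1 Z.2 P' →
          AlgPoints.baseChangeEquiv (algebraMap ℚ ℂ) 𝓜'.M (𝓜'.classifyingMap (specOver ℚ ℂ) P') =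
            AlgPoints.map (L := ℂ) ι' s →
          ∃ P : PolarizedAbelianSchemeWithLevel g N δ (specOver ℚ ℂ).left,
            IsAdmissibleAt hδ r (θ Z).1 (θ Z).2 P ∧
            AlgPoints.baseChangeEquiv (algebraMap ℚ ℂ) 𝓜.M (𝓜.classifyingMap (specOver ℚ ℂ) P) = Φ s)
    (hg : 0 < g) (hδ : IsPolarizationType δ) (hN : 3 ≤ N) (𝓜 : SiegelFineModuliScheme g N δ) :
    SmoothOfRelativeDimension (g * (g + 1) / 2) 𝓜.M.hom := by
  haveI : Smooth ((Motives.baseChange ℚ ℂ).obj 𝓜.M).hom := smooth_baseChange_M_of_F hF hg hδ hN 𝓜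
  haveI : SmoothOfRelativeDimension (g * (g + 1) / 2) ((Motives.baseChangeHom (algebraMap ℚ ℂ)).obj 𝓜.M).hom :=
    Literature.AlgebraicGeometry.Dimension.smoothOfRelativeDimension_of_forall_isClosed_finrank_cotangentSpace_eq
      ((Motives.baseChange ℚ ℂ).obj 𝓜.M).hom _
      (finrank_cotangentSpace_eq_of_pieceBounds ((Motives.baseChange ℚ ℂ).obj 𝓜.M) (g * (g + 1) / 2)
        (fun S' ι _ d _ q hq ↦ EquidimThickIffLe.stub_le' hF hg hδ hN 𝓜 S' ι d q hq)
        (fun S' ι _ d _ q hq ↦ EquidimNoThinPieceOpen.noThinPiece_of_quotientMaps₃ hF hQuot₃ N δ hg hδ hN 𝓜 S' ι d q hq))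
  exact Literature.AlgebraicGeometry.Limits.smoothOfRelativeDimension_hom_of_baseChangeHom_obj (algebraMap ℚ ℂ) _ 𝓜.M

/-- **THE E-ROAD HEAD modulo socket (B) v7: (F) ⇒ (F′)** (v7 of `relDim_of_quotientMaps`).
[cite: Lan2013PELCompactifications, Thm. 1.4.1.11] [cite: GortzWedhorn2023, Thm. 27.301 (p. 733)] -/
theorem relDim_of_quotientMaps₃ (hF : lan2013_siegelFineModuliScheme)
    (hQuot₃ : ∀ (_hF : lan2013_siegelFineModuliScheme) (g N N' : ℕ) (δ δ' : Fin g → ℕ) (_hg : 0 < g)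
      (hδ : IsPolarizationType δ) (_hN : 3 ≤ N) (hδ' : IsPolarizationType δ')
      (𝓜 : SiegelFineModuliScheme g N δ) (𝓜' : SiegelFineModuliScheme g N' δ')
      (S'' : SchemeOver ℂ) (ι' : S'' ⟶ (Motives.baseChange ℚ ℂ).obj 𝓜'.M) [IsOpenImmersion ι'.left]
      (d'' : ℕ) [SmoothOfRelativeDimension d'' S''.hom] (r' : gspFinAdelic δ') (_ : r' ∈ principalLevelSubgroup δ' 1)
      (s' : ComplexPoints S'') (_ : IsThickAtWith hδ' 𝓜' ι' d'' s' r')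
      (x : ComplexPoints ((Motives.baseChange ℚ ℂ).obj 𝓜.M)),
      HeckeLinkedDeg 𝓜 𝓜' r' (AlgPoints.map (L := ℂ) ι' s') x (N' / N) → Odd (N' / N) → Nat.Coprime (N' / N) (∏ i, δ i) →
      haveI : IsLocallyNoetherian (specOver ℚ ℂ).left := inferInstanceAs (IsLocallyNoetherian (Spec (CommRingCat.of ℂ)))
      ∃ (Φ : ComplexPoints S'' → ComplexPoints ((Motives.baseChange ℚ ℂ).obj 𝓜.M)) (_ : Continuous Φ) (_ : Φ s' = x)
        (θ : siegelUpperHalfSpace g → siegelUpperHalfSpace g) (_ : IsOpenMap θ)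
        (r : gspFinAdelic δ) (_ : r ∈ principalLevelSubgroup δ 1),
        ∀ (s : ComplexPoints S'') (Z : siegelUpperHalfSpace g)
          (P' : PolarizedAbelianSchemeWithLevel g N' δ' (specOver ℚ ℂ).left),
          IsAdmissibleAt hδ' r' Z.1 Z.2 P' →
          AlgPoints.baseChangeEquiv (algebraMap ℚ ℂ) 𝓜'.M (𝓜'.classifyingMap (specOver ℚ ℂ) P') =
            AlgPoints.map (L := ℂ) ι' s →
          ∃ P : PolarizedAbelianSchemeWithLevel g N δ (specOver ℚ ℂ).left,
            IsAdmissibleAt hδ r (θ Z).1 (θ Z).2 P ∧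
            AlgPoints.baseChangeEquiv (algebraMap ℚ ℂ) 𝓜.M (𝓜.classifyingMap (specOver ℚ ℂ) P) = Φ s) :
    lan2013_siegelFineModuliScheme_relDim := by
  intro g N δ hg hδ hN
  obtain ⟨𝓜, hs, hq, hX⟩ := hF g N δ hg hδ hN
  exact ⟨𝓜, hs, hq, hX, smoothOfRelativeDimension_of_quotientMaps₃ hF (fun hF' g ↦ hQuot₃ hF' g) hg hδ hN 𝓜⟩

/-- **THE hDel JUNCTION modulo socket (B) v7: (F) ⇒ hDel** (v7 of `HDel_of_quotientMaps`; ★ `HDel_of_F_U` + ★ `UOfF.U_of_relDim_F`).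
[cite: Lan2013PELCompactifications, Thm. 1.4.1.11 and Cor. 7.2.3.9–7.2.3.10] -/
theorem HDel_of_quotientMaps₃ (hF : lan2013_siegelFineModuliScheme)
    (hQuot₃ : ∀ (_hF : lan2013_siegelFineModuliScheme) (g N N' : ℕ) (δ δ' : Fin g → ℕ) (_hg : 0 < g)
      (hδ : IsPolarizationType δ) (_hN : 3 ≤ N) (hδ' : IsPolarizationType δ')
      (𝓜 : SiegelFineModuliScheme g N δ) (𝓜' : SiegelFineModuliScheme g N' δ')
      (S'' : SchemeOver ℂ) (ι' : S'' ⟶ (Motives.baseChange ℚ ℂ).obj 𝓜'.M) [IsOpenImmersion ι'.left]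
      (d'' : ℕ) [SmoothOfRelativeDimension d'' S''.hom] (r' : gspFinAdelic δ') (_ : r' ∈ principalLevelSubgroup δ' 1)
      (s' : ComplexPoints S'') (_ : IsThickAtWith hδ' 𝓜' ι' d'' s' r')
      (x : ComplexPoints ((Motives.baseChange ℚ ℂ).obj 𝓜.M)),
      HeckeLinkedDeg 𝓜 𝓜' r' (AlgPoints.map (L := ℂ) ι' s') x (N' / N) → Odd (N' / N) → Nat.Coprime (N' / N) (∏ i, δ i) →
      haveI : IsLocallyNoetherian (specOver ℚ ℂ).left := inferInstanceAs (IsLocallyNoetherian (Spec (CommRingCat.of ℂ)))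
      ∃ (Φ : ComplexPoints S'' → ComplexPoints ((Motives.baseChange ℚ ℂ).obj 𝓜.M)) (_ : Continuous Φ) (_ : Φ s' = x)
        (θ : siegelUpperHalfSpace g → siegelUpperHalfSpace g) (_ : IsOpenMap θ)
        (r : gspFinAdelic δ) (_ : r ∈ principalLevelSubgroup δ 1),
        ∀ (s : ComplexPoints S'') (Z : siegelUpperHalfSpace g)
          (P' : PolarizedAbelianSchemeWithLevel g N' δ' (specOver ℚ ℂ).left),
          IsAdmissibleAt hδ' r' Z.1 Z.2 P' →
          AlgPoints.baseChangeEquiv (algebraMap ℚ ℂ) 𝓜'.M (𝓜'.classifyingMap (specOver ℚ ℂ) P') =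
            AlgPoints.map (L := ℂ) ι' s →
          ∃ P : PolarizedAbelianSchemeWithLevel g N δ (specOver ℚ ℂ).left,
            IsAdmissibleAt hδ r (θ Z).1 (θ Z).2 P ∧
            AlgPoints.baseChangeEquiv (algebraMap ℚ ℂ) 𝓜.M (𝓜.classifyingMap (specOver ℚ ℂ) P) = Φ s) :
    Summit.HodgeConjecture.HodgeConjecture.Theses.HCCMUnconditional.HDel :=
  HDel_of_F_U hF (UOfF.U_of_relDim_F (relDim_of_quotientMaps₃ hF hQuot₃))

end EquidimRelDimOfQuotientMaps

end Summit.HodgeConjecture.HodgeConjecture.Theorems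

end
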